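import Summits.BirchSwinnertonDyer.BirchSwinnertonDyer.Theses.PAdicOrderV2
import Summits.BirchSwinnertonDyer.BirchSwinnertonDyer.Theorems.PAdicOrderV2PAdicOrderThesisR2StubUBRank0
import Literature.NumberTheory.EllipticCurves.OrdinaryPrimesProofs
import Literature.Barriers.BirchSwinnertonDyer.PAdicFunctionalEquationParityProofs

/-!
# `PAdicOrderPadicBSDrankR2` (crux stmt-BirchSwinnertonDyer-0490, routes `PAdicOrderV2` / `PAdicOrder`):
# what any proof must deliver — the crux implies the rank-zero case of BSD in BOTH directions and
# the Mordell–Weil parity conjecture (negative-side support, refuter crux-disprover seat; lower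
# bounds on difficulty, NOT a refutation)

Write `S` for the crux (`ord_{T=0} L_p(f, unitRoot W p, T) = rank_ℤ W(ℚ)` at every good ordinary
prime `p` and the newform `f` of `W`). Two closed-form windows on the left-hand side are THEOREMS
of the tree: the level-zero window `ord_T L_p = 0 ↔ ord_{s=1} L(E,s) = 0` (interpolation
`L_p(E,0) = (1-α⁻¹)² L(E,1)/Ω⁺`, `α ≠ 1`, `Ω⁺ > 0`;
`Cruxes.PAdicOrderThesisR2.KatoSandwich.order_padicLFunction_eq_zero_iff_analyticRank_eq_zero`) and
the parity window `ord_T L_p ≡ ord_{s=1} L(E,s) (mod 2)` at an odd ordinary prime of conductor level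
(`Literature.Barriers.BirchSwinnertonDyer.even_order_padicLFunction_iff_even_analyticRank_conductorLevel`,
Greenberg LNM 1716 §5). Reading `S` through them gives, sorry-free:

* `rank_eq_zero_iff_analyticRank_eq_zero_of_crux` — `S ⇒ (rank W(ℚ) = 0 ↔ r_an(W) = 0)` at every
  good ordinary point `(W, p, f)`; `bsdRank_rankZero_cases_of_crux` — `S ∧ exists_isNewformOf ⇒`
  the same for EVERY elliptic globally minimal `W/ℚ` (a good ordinary `p ≥ 5` exists per curve,
  `WeierstrassCurve.exists_good_ordinary_prime_holds`). The direction `rank = 0 ⇒ L(E,1) ≠ 0` is the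
  open rank-zero converse to Kolyvagin: `S` is at least that hard, with no help from the route's
  comparison crux #2.
* `even_mordellWeilRank_iff_even_analyticRank_of_crux` — `S ⇒ (rank ≡ r_an (mod 2))` at every odd
  good ordinary point of conductor level; `mordellWeilParity_of_crux` — `S ∧ exists_isNewformOf ⇒`
  the Mordell–Weil parity conjecture `rank_ℤ E(ℚ) ≡ ord_{s=1} L(E,s) (mod 2)` for every `E/ℚ`
  (open in print; known for `p^∞`-Selmer coranks, Dokchitser–Dokchitser 2010).

`exists_isNewformOf` (modularity, Breuil–Conrad–Diamond–Taylor) enters only to supply the newform;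
it is a hypothesis here, never asserted.
-/

noncomputable section

-- D-0017: single-problem summit, so `Summit.BirchSwinnertonDyer.BirchSwinnertonDyer.…` repeats a
-- namespace BY DESIGN.
set_option linter.dupNamespace false

namespace Summit.BirchSwinnertonDyer.BirchSwinnertonDyer.Theorems.PAdicOrderPadicBSDrankR2.Negative

open scoped MatrixGroups ModularForm
open CongruenceSubgroup Literature.NumberTheory.EllipticCurves
  Literature.NumberTheory.EllipticCurves.ModularForms
open Summit.BirchSwinnertonDyer.BirchSwinnertonDyer.Theses.PAdicOrderV2

section Consequences

variable (hS : PAdicOrderPadicBSDrankR2)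
include hS

/-- **`S` decides rank zero against analytic rank zero at every good ordinary point**: from the
proved level-zero window `ord_T L_p = 0 ↔ r_an = 0`, the crux gives `rank W(ℚ) = 0 ↔ r_an(W) = 0`.
[folklore] -/
theorem rank_eq_zero_iff_analyticRank_eq_zero_of_crux (W : WeierstrassCurve ℚ) [W.IsElliptic]
    [W.IsGloballyMinimal] (p : ℕ) [Fact p.Prime] (hord : IsOrdinaryAt W p) {N : ℕ} [NeZero N]
    (f : CuspForm (Gamma0 N) 2) (hf : IsNewformOf W f) :
    W.mordellWeilRank = 0 ↔ W.analyticRank = 0 := by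
  rw [← Cruxes.PAdicOrderThesisR2.KatoSandwich.order_padicLFunction_eq_zero_iff_analyticRank_eq_zero
    W p hord hf, hS W p hord f hf]
  exact_mod_cast Iff.rfl

/-- **`S` forces Mordell–Weil parity at every odd good ordinary point of conductor level**: with
the proved `p`-adic parity `ord_T L_p ≡ r_an (mod 2)` (`p` odd, `f` of level `N_W`), the crux gives
`rank W(ℚ) ≡ r_an(W) (mod 2)`. [folklore] -/
theorem even_mordellWeilRank_iff_even_analyticRank_of_crux (W : WeierstrassCurve ℚ) [W.IsElliptic]
    [W.IsGloballyMinimal] (p : ℕ) [Fact p.Prime] (hp : p ≠ 2) (hord : IsOrdinaryAt W p)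
    [NeZero (W.conductorNorm ℤ)] (f : CuspForm (Gamma0 (W.conductorNorm ℤ)) 2)
    (hf : IsNewformOf W f) : Even W.mordellWeilRank ↔ Even W.analyticRank := by
  rw [← Literature.Barriers.BirchSwinnertonDyer.even_order_padicLFunction_iff_even_analyticRank_conductorLevel
    hp hord hf, hS W p hord f hf]
  simp

omit hS in
/-- Bookkeeping: every elliptic globally minimal `W/ℚ` has an ODD good ordinary prime (indeed one
`≥ 5`: tree theorem `exists_good_ordinary_prime_holds`, Serre 1981 §8 / elementary). [folklore] -/
theorem exists_odd_isOrdinaryAt (W : WeierstrassCurve ℚ) [W.IsElliptic] [W.IsGloballyMinimal] :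
    ∃ (p : ℕ) (_ : Fact p.Prime), p ≠ 2 ∧ IsOrdinaryAt W p := by
  obtain ⟨p, hp, h5, hgood, hord⟩ := WeierstrassCurve.exists_good_ordinary_prime_holds W
  exact ⟨p, hp, by omega, hgood, hord⟩

/-- **`S ∧` modularity `⇒` the rank part of BSD on `{rank = 0} ∪ {r_an = 0}`**: for every elliptic
globally minimal `W/ℚ`, `rank W(ℚ) = 0 ↔ r_an(W) = 0` (newform from `exists_isNewformOf`, `NeZero`
level by `conductorNorm_pos_holds`, an ordinary prime by `exists_odd_isOrdinaryAt`). [folklore] -/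
theorem bsdRank_rankZero_cases_of_crux (hmod : exists_isNewformOf) (W : WeierstrassCurve ℚ)
    [W.IsElliptic] [W.IsGloballyMinimal] : W.mordellWeilRank = 0 ↔ W.analyticRank = 0 := by
  haveI : NeZero (W.conductorNorm ℤ) := ⟨(WeierstrassCurve.conductorNorm_pos_holds (W := W)).ne'⟩
  obtain ⟨f, hf⟩ := hmod W
  obtain ⟨p, hp, -, hord⟩ := exists_odd_isOrdinaryAt W
  exact rank_eq_zero_iff_analyticRank_eq_zero_of_crux hS W p hord f hf

/-- **`S ∧` modularity `⇒` the Mordell–Weil parity conjecture**: for every elliptic globally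
minimal `W/ℚ`, `rank W(ℚ) ≡ ord_{s=1} L(W,s) (mod 2)`. [folklore] -/
theorem mordellWeilParity_of_crux (hmod : exists_isNewformOf) (W : WeierstrassCurve ℚ)
    [W.IsElliptic] [W.IsGloballyMinimal] : Even W.mordellWeilRank ↔ Even W.analyticRank := by
  haveI : NeZero (W.conductorNorm ℤ) := ⟨(WeierstrassCurve.conductorNorm_pos_holds (W := W)).ne'⟩
  obtain ⟨f, hf⟩ := hmod W
  obtain ⟨p, hp, hp2, hord⟩ := exists_odd_isOrdinaryAt W
  exact even_mordellWeilRank_iff_even_analyticRank_of_crux hS W p hp2 hord f hf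

end Consequences

end Summit.BirchSwinnertonDyer.BirchSwinnertonDyer.Theorems.PAdicOrderPadicBSDrankR2.Negative

end
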